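import Summits.Parity.GeneralizedHardyLittlewood.Theses.LiouvilleShiftedTables

/-!
# Smooth-part mass at the class `w = 0` — negative knowledge for `TypeI2Dilated` (stmt-Parity-14272)

Companion to `Negative.inner_w0_undilate` (Structure.lean, the coprime case `(q, rs) = 1`, where the class
`r s n ≡ 0 (mod q)` is `q ∣ n` and thins the `n`-range by `1/q`).  In general the class is
`q / gcd(q, rs) ∣ n` (`mul_modEq_zero_iff_div_gcd_dvd`), so the `(q, r, s)` term of the crux's left side at
`w = 0` counts `⌊y/(rs)⌋ / (q / gcd(q, rs))` integers `n` (`card_inner_w0`), and when `q ∣ r s` the class is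
VACUOUS (`inner_w0_of_dvd`: full density, no `1/q` thinning at all).

Consequence recorded by drefute gen-3 (`Cruxes/TypeI2Dilated/DrefuteG3StubAssemble.md`): in any assembly of
the line `peel-to-drappeau` the `(qrc)`-smooth part of `s` cannot be cut at `(log x)^C` "by Rankin on average
over `(q, r)`" — the terms with `gcd(q, s) > (log x)^C` carry a share `1 − O(C log log x / (ρ log x))` of the
trivial mass `∑_{q,r,s} y·gcd(q, rs)/(q r s)`; only the cofactor `k / gcd(q, k)` of the smooth part `k` is
cuttable at a power of `log x`.
-/

namespace Summit.Parity.GeneralizedHardyLittlewood.Cruxes.TypeI2Dilated.Negative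

open Finset

/-- `t · n ≡ 0 (mod q)` iff `q / gcd(q, t) ∣ n` (`q ≥ 1`). [folklore] -/
theorem mul_modEq_zero_iff_div_gcd_dvd {q : ℕ} (hq : 0 < q) (t n : ℕ) :
    t * n ≡ 0 [MOD q] ↔ q / Nat.gcd q t ∣ n := by
  rw [Nat.modEq_zero_iff_dvd]
  have hg0 : 0 < Nat.gcd q t := Nat.gcd_pos_of_pos_left t hq
  have hcop : Nat.Coprime (q / Nat.gcd q t) (t / Nat.gcd q t) := Nat.coprime_div_gcd_div_gcd hg0
  have hq' : Nat.gcd q t * (q / Nat.gcd q t) = q := Nat.mul_div_cancel' (Nat.gcd_dvd_left q t)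
  have ht' : Nat.gcd q t * (t / Nat.gcd q t) = t := Nat.mul_div_cancel' (Nat.gcd_dvd_right q t)
  constructor
  · intro h
    have h1 : Nat.gcd q t * (q / Nat.gcd q t) ∣ Nat.gcd q t * (t / Nat.gcd q t * n) := by
      rw [hq', ← mul_assoc, ht']
      exact h
    exact hcop.dvd_of_dvd_mul_left ((Nat.mul_dvd_mul_iff_left hg0).1 h1)
  · intro h
    have h1 : Nat.gcd q t * (q / Nat.gcd q t) ∣ Nat.gcd q t * (t / Nat.gcd q t * n) :=
      mul_dvd_mul_left _ (h.mul_left _)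
    rwa [hq', ← mul_assoc, ht'] at h1

/-- `#{1 ≤ n ≤ N : t n ≡ 0 (mod q)} = N / (q / gcd(q, t))` (`q ≥ 1`): the class of the dilation modulus thins
the `n`-range by `gcd(q, t)/q`, not by `1/q`. [folklore] -/
theorem card_filter_mul_modEq_zero {q : ℕ} (hq : 0 < q) (t N : ℕ) :
    ((Icc 1 N).filter (fun n : ℕ => t * n ≡ 0 [MOD q])).card = N / (q / Nat.gcd q t) := by
  have h : (Icc 1 N).filter (fun n : ℕ => t * n ≡ 0 [MOD q]) =
      (Ioc 0 N).filter (fun n : ℕ => q / Nat.gcd q t ∣ n) := by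
    rw [show (1 : ℕ) = Order.succ 0 from rfl, Finset.Icc_succ_left_eq_Ioc]
    exact Finset.filter_congr (fun n _ => mul_modEq_zero_iff_div_gcd_dvd hq t n)
  rw [h, Nat.Ioc_filter_dvd_card_eq_div]

/-- **The `n`-count of the `(q, r, s)` term of `TypeI2Dilated`'s left side at the class `w = 0`** is
`⌊y/(sr)⌋ / (q / gcd(q, rs))` — i.e. `≍ y · gcd(q, rs)/(q r s)`, not `y/(q r s)`. [folklore] -/
theorem card_inner_w0 {q : ℕ} (hq : 0 < q) (r s : ℕ) (y : ℝ) :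
    ((Finset.Icc 1 ⌊y / (s * r)⌋₊).filter (fun n : ℕ => r * s * n ≡ 0 [MOD q])).card =
      ⌊y / (s * r)⌋₊ / (q / Nat.gcd q (r * s)) :=
  card_filter_mul_modEq_zero hq (r * s) _

/-- **When `q ∣ r s` the class `r s n ≡ 0 (mod q)` is vacuous**: the filtered inner sum of the crux at `w = 0`
equals the unfiltered one (full density — this is the mass that defeats a `(log x)^C` cut of the smooth part
of `s` in the dispersion range; cf. `inner_w0_undilate` for the complementary coprime case). [folklore] -/
theorem inner_w0_of_dvd (f : ℕ → ℝ) (c : ℤ) {q r s : ℕ} (h : q ∣ r * s) (y : ℝ) :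
    ∑ n ∈ (Finset.Icc 1 ⌊y / (s * r)⌋₊).filter (fun n : ℕ => r * s * n ≡ 0 [MOD q]),
        f (Int.toNat ((r : ℤ) * s * n + c)) =
      ∑ n ∈ Finset.Icc 1 ⌊y / (s * r)⌋₊, f (Int.toNat ((r : ℤ) * s * n + c)) := by
  congr 1
  refine Finset.filter_true_of_mem (fun n _ => ?_)
  exact Nat.modEq_zero_iff_dvd.mpr (h.mul_right n)

end Summit.Parity.GeneralizedHardyLittlewood.Cruxes.TypeI2Dilated.Negative
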